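import Literature.Analysis.FluidPDE.ElgindiPsiStar
import HarnessLib

/-!
# The polar operator on separated profiles `a(R)·cos θ sinʲθ` (angular monomial modes)
([Elgindi2021] §7.1: "`sin(2θ)` is in the kernel of `L`" at `α = 0`, Step 1 of Proposition 7.1)

Topic `Literature/Analysis/FluidPDE`. Proof file (everything proved, no definitions, no named
facts) on the proof path of the named fact
`Literature.Analysis.FluidPDE.Elgindi.ElgindiGhoulMasmoudi2021_stabilityCore`
(`ElgindiStabilityDecomposition.lean`). T. M. Elgindi, Ann. of Math. 194 (2021) =
arXiv:1904.04795, §7.1 p. 19 and §7.5 p. 23 of the held text: "when `α = 0`, `sin(2θ)` is in the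
kernel of `L`" and "`L(G(R) sin(2θ)) = (α²R²∂_{RR}G + α(5+α)R∂_RG) sin(2θ)`".

The angular part `𝒜u = −u″ + (tan θ·u)′` of `L` acts on the monomial profiles `cos θ sinʲθ` by a
TRIANGULAR rule,
`𝒜(cos θ sinʲθ) = (j+1)(j+2)·cos θ sinʲθ − j(j−1)·cos θ sin^{j−2}θ` (`angularOp_monomial`),
so that (`ellipticOp_radial_mul_monomial`)
`L(a(R)cos θ sinʲθ) = (Euler a)(R)·cos θ sinʲθ + a(R)[((j+1)(j+2) − 6)cos θ sinʲθ − j(j−1)cos θ sin^{j−2}θ]`,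
`Euler a = −α²R²a″ − α(5+α)Ra′`; for `j = 1` this is Elgindi's display (`(1+1)(1+2) = 6`). These
separated profiles are the test functions of the uniqueness argument for finite-energy very weak
solutions (polynomial angular modes and radial Euler equations).
-/

noncomputable section

open MeasureTheory Set Real Filter Function
open _root_.Topology

namespace Literature.Analysis.FluidPDE

namespace Elgindi

/-! ### Derivatives of the angular monomials -/

/-- `(sin^{n} θ)′ = n sin^{n−1}θ cos θ`. [folklore] -/
theorem hasDerivAt_sin_pow (n : ℕ) (θ : ℝ) :
    HasDerivAt (fun θ => Real.sin θ ^ n) ((n : ℝ) * Real.sin θ ^ (n - 1) * Real.cos θ) θ := by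
  have h := (Real.hasDerivAt_sin θ).pow n
  exact h

/-- The first derivative of `m_j = cos θ sinʲθ` (`j ≥ 1`): `m_j′ = j sin^{j−1}θ cos²θ − sin^{j+1}θ`. [folklore] -/
theorem hasDerivAt_monomial (j : ℕ) (θ : ℝ) :
    HasDerivAt (fun θ => Real.cos θ * Real.sin θ ^ j) ((j : ℝ) * Real.sin θ ^ (j - 1) * Real.cos θ ^ 2 - Real.sin θ ^ (j + 1)) θ := by
  have h := (Real.hasDerivAt_cos θ).mul (hasDerivAt_sin_pow j θ)
  refine h.congr_deriv ?_
  have e : Real.sin θ ^ (j + 1) = Real.sin θ * Real.sin θ ^ j := by rw [pow_succ]; ring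
  rw [e]; ring

/-- `tan θ·m_j = sin^{j+1}θ` where `cos θ ≠ 0`. [folklore] -/
theorem tan_mul_monomial {θ : ℝ} (hθ : Real.cos θ ≠ 0) (j : ℕ) :
    Real.tan θ * (Real.cos θ * Real.sin θ ^ j) = Real.sin θ ^ (j + 1) := by
  rw [Real.tan_eq_sin_div_cos, pow_succ]; field_simp

/-- **The angular operator on monomials**: with `m_j = cos θ sinʲθ`, `j ≥ 1`, on `cos θ ≠ 0`:
`−m_j″ + (tan θ m_j)′ = (j+1)(j+2)m_j − j(j−1)cos θ sin^{j−2}θ`. [cite: Elgindi2021, §7.5 (p. 23 of arXiv:1904.04795), "sin(2θ) is in the kernel of L" for j = 1] -/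
theorem angularOp_monomial {j : ℕ} (hj : 1 ≤ j) {θ : ℝ} (hθ : Real.cos θ ≠ 0) :
    -deriv (deriv fun θ => Real.cos θ * Real.sin θ ^ j) θ + deriv (fun θ => Real.tan θ * (Real.cos θ * Real.sin θ ^ j)) θ =
      ((j : ℝ) + 1) * ((j : ℝ) + 2) * (Real.cos θ * Real.sin θ ^ j) - (j : ℝ) * ((j : ℝ) - 1) * (Real.cos θ * Real.sin θ ^ (j - 2)) := by
  -- first derivative as a function
  have e1 : deriv (fun θ => Real.cos θ * Real.sin θ ^ j) = fun θ => (j : ℝ) * Real.sin θ ^ (j - 1) * Real.cos θ ^ 2 - Real.sin θ ^ (j + 1) :=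
    funext fun θ => (hasDerivAt_monomial j θ).deriv
  -- second derivative
  have h2 : HasDerivAt (fun θ => (j : ℝ) * Real.sin θ ^ (j - 1) * Real.cos θ ^ 2 - Real.sin θ ^ (j + 1))
      ((j : ℝ) * (((j - 1 : ℕ) : ℝ) * Real.sin θ ^ (j - 1 - 1) * Real.cos θ) * Real.cos θ ^ 2 +
        (j : ℝ) * Real.sin θ ^ (j - 1) * (2 * Real.cos θ * -Real.sin θ) -
        ((j + 1 : ℕ) : ℝ) * Real.sin θ ^ (j + 1 - 1) * Real.cos θ) θ := by
    have hc2 : HasDerivAt (fun θ => Real.cos θ ^ 2) (2 * Real.cos θ * -Real.sin θ) θ := by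
      have := (Real.hasDerivAt_cos θ).pow 2
      refine this.congr_deriv ?_
      simp
    have a := ((hasDerivAt_sin_pow (j - 1) θ).const_mul (j : ℝ)).mul hc2
    have b := hasDerivAt_sin_pow (j + 1) θ
    exact a.sub b
  rw [e1, h2.deriv]
  -- the `tan` term: `(sin^{j+1})'`, valid near `θ` since `cos ≠ 0` on a neighbourhood
  have htan : deriv (fun θ => Real.tan θ * (Real.cos θ * Real.sin θ ^ j)) θ = ((j + 1 : ℕ) : ℝ) * Real.sin θ ^ (j + 1 - 1) * Real.cos θ := by
    have hev : (fun θ => Real.tan θ * (Real.cos θ * Real.sin θ ^ j)) =ᶠ[𝓝 θ] fun θ => Real.sin θ ^ (j + 1) := by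
      have hopen : IsOpen {x : ℝ | Real.cos x ≠ 0} := isOpen_ne_fun Real.continuous_cos continuous_const
      filter_upwards [hopen.mem_nhds hθ] with x hx using tan_mul_monomial hx j
    rw [hev.deriv_eq, (hasDerivAt_sin_pow (j + 1) θ).deriv]
  rw [htan]
  -- casts and exponents
  have c1 : ((j - 1 : ℕ) : ℝ) = (j : ℝ) - 1 := by rw [Nat.cast_sub hj]; simp
  have c2 : ((j + 1 : ℕ) : ℝ) = (j : ℝ) + 1 := by push_cast; ring
  have ej : j + 1 - 1 = j := by omega
  have ej2 : j - 1 - 1 = j - 2 := by omega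
  rw [c1, c2, ej, ej2]
  -- reduce powers: `sin^{j} = sin^{j-1}·sin` and `sin^{j-1}` vs `sin^{j-2}`
  rcases Nat.lt_or_ge j 2 with hj1 | hj2
  · -- `j = 1`
    have hj' : j = 1 := by omega
    subst hj'
    simp
    ring
  · have p1 : Real.sin θ ^ j = Real.sin θ ^ (j - 2) * Real.sin θ ^ 2 := by
      rw [← pow_add]; congr 1; omega
    have p2 : Real.sin θ ^ (j - 1) = Real.sin θ ^ (j - 2) * Real.sin θ := by
      rw [← pow_succ]; congr 1; omega
    have p3 : Real.sin θ ^ (j + 1) = Real.sin θ ^ (j - 2) * Real.sin θ ^ 3 := by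
      rw [← pow_add]; congr 1; omega
    rw [p1, p2]
    have hsc : Real.sin θ ^ 2 + Real.cos θ ^ 2 = 1 := Real.sin_sq_add_cos_sq θ
    have hc2 : Real.cos θ ^ 2 = 1 - Real.sin θ ^ 2 := by linarith
    rw [hc2]
    ring

/-! ### `L` on separated profiles -/

/-- **`L(a(R)·cos θ sinʲθ) = (Euler a)·cos θ sinʲθ + a·[((j+1)(j+2) − 6)cos θ sinʲθ − j(j−1)cos θ sin^{j−2}θ]`**
on the strip (`j ≥ 1`, `a ∈ C²`). [cite: Elgindi2021, §7.5 (p. 23 of arXiv:1904.04795): L(G(R)sin 2θ) = (α²R²G″ + α(5+α)RG′)sin 2θ] -/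
theorem ellipticOp_radial_mul_monomial (α : ℝ) {a : ℝ → ℝ} (ha : ContDiff ℝ 2 a) {j : ℕ} (hj : 1 ≤ j) {p : ℝ × ℝ} (hp : p ∈ strip) :
    ellipticOp α (fun R θ => a R * (Real.cos θ * Real.sin θ ^ j)) p.1 p.2 =
      (-α ^ 2 * p.1 ^ 2 * deriv (deriv a) p.1 - α * (5 + α) * p.1 * deriv a p.1) * (Real.cos p.2 * Real.sin p.2 ^ j) +
        a p.1 * ((((j : ℝ) + 1) * ((j : ℝ) + 2) - 6) * (Real.cos p.2 * Real.sin p.2 ^ j) -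
          (j : ℝ) * ((j : ℝ) - 1) * (Real.cos p.2 * Real.sin p.2 ^ (j - 2))) := by
  have hcos : Real.cos p.2 ≠ 0 := (Real.cos_pos_of_mem_Ioo ⟨by linarith [hp.2.1, Real.pi_pos], hp.2.2⟩).ne'
  set m : ℝ → ℝ := fun θ => Real.cos θ * Real.sin θ ^ j with hm
  have hda : Differentiable ℝ a := ha.differentiable (by norm_num)
  have ha1 : ContDiff ℝ 1 (deriv a) := by have := ha.iterate_deriv' 1 1; simpa using this
  have hda' : Differentiable ℝ (deriv a) := ha1.differentiable (by norm_num)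
  have hdm : Differentiable ℝ m := fun θ => (hasDerivAt_monomial j θ).differentiableAt
  -- radial derivatives
  have dz1 : ∀ R θ, dz (fun R θ => a R * m θ) R θ = deriv a R * m θ := fun R θ => by
    show deriv (fun R' => a R' * m θ) R = _
    rw [deriv_mul_const (hda R)]
  have dz2 : dz (dz fun R θ => a R * m θ) p.1 p.2 = deriv (deriv a) p.1 * m p.2 := by
    have e : dz (fun R θ => a R * m θ) = fun R θ => deriv a R * m θ := by funext R θ; exact dz1 R θ
    rw [e]
    show deriv (fun R' => deriv a R' * m p.2) p.1 = _
    rw [deriv_mul_const (hda' p.1)]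
  -- angular derivatives
  have dθ1 : dθ (fun R θ => a R * m θ) = fun R θ => a R * deriv m θ := by
    funext R θ
    show deriv (fun θ' => a R * m θ') θ = _
    rw [deriv_const_mul _ (hdm θ)]
  have dθ2 : dθ (dθ fun R θ => a R * m θ) p.1 p.2 = a p.1 * deriv (deriv m) p.2 := by
    rw [dθ1]
    show deriv (fun θ' => a p.1 * deriv m θ') p.2 = _
    have hdm' : DifferentiableAt ℝ (deriv m) p.2 := by
      have e1 : deriv m = fun θ => (j : ℝ) * Real.sin θ ^ (j - 1) * Real.cos θ ^ 2 - Real.sin θ ^ (j + 1) :=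
        funext fun θ => (hasDerivAt_monomial j θ).deriv
      rw [e1]; fun_prop
    rw [deriv_const_mul _ hdm']
  have dθt : dθ (fun R θ => Real.tan θ * (a R * m θ)) p.1 p.2 = a p.1 * deriv (fun θ => Real.tan θ * m θ) p.2 := by
    show deriv (fun θ' => Real.tan θ' * (a p.1 * m θ')) p.2 = _
    have e : (fun θ' => Real.tan θ' * (a p.1 * m θ')) = fun θ' => a p.1 * (Real.tan θ' * m θ') := by funext θ'; ring
    rw [e]
    have hdt : DifferentiableAt ℝ (fun θ => Real.tan θ * m θ) p.2 :=
      ((Real.differentiableAt_tan.2 hcos).mul (hdm p.2))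
    rw [deriv_const_mul _ hdt]
  unfold ellipticOp
  rw [dz2, dz1, dθ2, dθt]
  have hA := angularOp_monomial hj hcos (θ := p.2)
  simp only [hm] at hA ⊢
  have : a p.1 * (-deriv (deriv fun θ => Real.cos θ * Real.sin θ ^ j) p.2 + deriv (fun θ => Real.tan θ * (Real.cos θ * Real.sin θ ^ j)) p.2) =
      a p.1 * (((j : ℝ) + 1) * ((j : ℝ) + 2) * (Real.cos p.2 * Real.sin p.2 ^ j) - (j : ℝ) * ((j : ℝ) - 1) * (Real.cos p.2 * Real.sin p.2 ^ (j - 2))) := by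
    rw [hA]
  linear_combination this

/-- The case `j = 1`: `L(a(R) cos θ sin θ) = (Euler a)(R)·cos θ sin θ` — Elgindi's display
`L(G sin 2θ) = (α²R²G″ + α(5+α)RG′) sin 2θ` up to the sign convention `Euler a = −(α²R²a″ + α(5+α)Ra′)`
of `ellipticOp`. [cite: Elgindi2021, §7.5 (p. 23 of arXiv:1904.04795)] -/
theorem ellipticOp_radial_mul_sin_cos (α : ℝ) {a : ℝ → ℝ} (ha : ContDiff ℝ 2 a) {p : ℝ × ℝ} (hp : p ∈ strip) :
    ellipticOp α (fun R θ => a R * (Real.cos θ * Real.sin θ)) p.1 p.2 =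
      (-α ^ 2 * p.1 ^ 2 * deriv (deriv a) p.1 - α * (5 + α) * p.1 * deriv a p.1) * (Real.cos p.2 * Real.sin p.2) := by
  have h := ellipticOp_radial_mul_monomial α ha (le_refl 1) hp
  simp only [pow_one, Nat.cast_one] at h
  rw [h]; ring

end Elgindi

end Literature.Analysis.FluidPDE
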